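import Summits.BirchSwinnertonDyer.BirchSwinnertonDyer.Theorems.ErratumRoadFiveSkinnerZhang13ByName
import Summits.BirchSwinnertonDyer.BirchSwinnertonDyer.Theses.KolyvaginRoadThree
import Summits.BirchSwinnertonDyer.Rank1Residual.X11b.Three.SkinnerZhangSharp
import HarnessLib

/-!
# Rung K2 (class X11b, p ∥ N, any odd p): ONE non-zero Kolyvagin class at ANY frame of a Hoffstein–Luo
# field gives `BSD(E,p)` on the Locus — the ∃-frame weakening of the Kolyvagin-road cruxes suffices
# (cell `bsd-stepL`, seat `bsd-stepL-mult-p3`, session g0; `--supports stmt-BirchSwinnertonDyer-19574`)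

HONEST FRAMING (cell `bsd-stepL`): kernel glue, CONDITIONAL on the binders (published named facts; the
LINE-K fact `McCallum1991_pow_dvd_card_sha_primary_of_certificate`; a Kolyvagin WITNESS or a typed crux as
hypothesis). Nothing is booked (T7); no crux is closed; BSD is proved for no curve unconditionally.

WHAT THIS FILE RECORDS. The STEP-L transport of `ErratumRoadFiveSkinnerZhang13ByName.lean`
(`Koly.indexLowerBoundAt_of_zsmul_eq_zsmul`: Heegner points of two parametrisation data are proportional,
and STEP L passes from any frame to a Manin-good one with the same `(β, ι)`) makes the FRAME of a Kolyvagin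
witness irrelevant. Consequences, at every odd `p`:
* §1 `Koly.bsdp_of_kolyvaginWitness_of_mccallum` — `(E,p) ∈` X11b, `p` odd, a (ram) witness, `p ∤ ∏c`; `K` a
  Hoffstein–Luo field (`d_K` odd, `< −4`, Heegner for `N`, `L(E^{d_K},1) ≠ 0`); ONE datum
  `d : KolyvaginHeegnerData Dt' β' ι' n` at ANY frame with `n ∈ Λ` and `c_1(n) ≠ 0` ⟹ `BSDp W p`.
* §2 `Koly.bsdp_of_skinnerZhangSharp_of_mccallum` — `p ≥ 5`: the cell's typed crux K-SZ14♯
  `Koly.SkinnerZhangSharp W p K` (∃-framed; MEMO-v5, referee PASS; `@[conjecture]`) at the Hoffstein–Luo fields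
  ⟹ `BSDp W p` on the WHOLE Locus (X11b ∧ `5 ≤ p` ∧ Ram ∧ `p ∤ ∏c`; cw 2 093 111 = 92.3 % of the B9 pairs) —
  previously the Locus was reached only from the STRONGER ∀-frame HL typing (`kolyvaginFramesHL`, imc-p1
  `Koly.openInputOnTree_onLocus_of_kolyvaginFramesHL_of_thm331Mult`); `Koly.exists_indexLowerBoundAt_of_skinnerZhangSharp_of_mccallum`
  stopped at STEP L for the witness frame.
* §4 `p ≥ 5`: `Koly.bsdp_of_skinnerZhangFlat_of_mccallum` — the memo-proved SZ14♭ (Thm 1.3 minus the `𝓛`-clause,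
  THEOREM B♭) ⟹ `BSDp W p` on its locus (Tamagawa condition implied).
* §3 `p = 3`, route `KolyvaginRoadThree`: the ∃-FRAME WEAKENING of the deciding crux 19574 —
  `∀` Hoffstein–Luo A1 pair `(E,K)`, `∃ (Dt β ι n d)`, `n ∈ Λ₃ ∧ c_1(n) ≠ 0` (no Manin-good binder, no ∀ over
  frames) — ALREADY implies the leaf on A1 (`Koly.bsdp_three_onA1_of_existsKolyvaginWitnessHL`), and is implied
  by the crux (`Koly.existsKolyvaginWitnessHL_of_zhangSharpFrameAtThreeHL`, via a Manin-good frame which exists);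
  with koly's `zhangSharpFrameAtThreeHL_of_bsdp_onA1` (CruxIffLeaf) the three statements {crux 19574 (∀-frame),
  its ∃-frame weakening, BSD₃ on A1} are EQUIVALENT modulo the published inputs. RESHAPE OPTION for the line
  owner ∕ planner: S1 ∕ S2-KS may be asked at ONE convenient frame per (E,K) (e.g. a minimal parametrisation and
  one orientation) instead of at every Manin-good frame.

References: [SkinnerZhang2014] Thm. 1.3; [WZhang2014] Thm. 1.1, Remark 5, Thm. 10.2; [McCallumLMS1991] §5
Cor. 5.6; [GrossZagier1986]; [Skinner2016PacificMC] Thm. C; [Mazur1978] Cor. 4.1; [Miller2011LMS] Def. 1.1.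
-/

set_option autoImplicit false

noncomputable section

open scoped Classical

namespace Summit.BirchSwinnertonDyer.Rank1Residual.X11b.Three.Koly

open WeierstrassCurve NumberField Literature.NumberTheory.EllipticCurves
  Literature.NumberTheory.EllipticCurves.ModularForms
  Literature.NumberTheory.EllipticCurves.Rank1Residual
  Summit.BirchSwinnertonDyer.Rank1Residual Summit.BirchSwinnertonDyer.Rank1Residual.X11b

/-! ### §1 One Kolyvagin witness at any frame of a Hoffstein–Luo field ⟹ `BSD(E,p)` (odd `p`) -/

/-- **`BSD(E,p)` from ONE non-zero Kolyvagin class at ANY frame of a Hoffstein–Luo field.** Data: `W/ℚ`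
globally minimal, `(E,p) ∈` X11b (`p` odd), a (ram) witness, `p ∤ ∏_ℓ c_ℓ(E)`; `K` imaginary quadratic with
`d_K` odd, `d_K < −4`, Heegner for `N_E`, `L(E^{d_K},1) ≠ 0`; a Kolyvagin–Heegner datum `d` of square-free
Kolyvagin conductor `n ∈ Λ_p` at an ARBITRARY frame `(Dt', β', ι')` whose class `c_1(n) ∈ H¹(K, E[p])` is
non-zero. Conclusion: `BSDp W p`. Proof: McCallum's structure theorem at the witness frame
(`indexLowerBoundAt_of_kolyvaginClass_one_ne_zero_of_mccallum`; tower surjectivity from `Surj ∧ Ram`, non-CM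
from `p ∥ N`, `E(K)[p] = 0`, rank one and finite `Ш(E/K)` from Kolyvagin at the non-torsion Heegner point)
⟹ STEP L at `y_K^{(Dt',β',ι')}` ⟹ transported (`indexLowerBoundAt_of_zsmul_eq_zsmul`) to the Heegner point of
a Manin-good datum `Dt` (`exists_modularParametrizationData_not_dvd`) at the same `(β', ι')` ⟹
`bsdp_of_indexLowerBoundAt_of_heegnerData_of_odd`. CONDITIONAL on the binders; nothing booked.
[cite: McCallumLMS1991, §5 Cor. 5.6 (p. 310)] [cite: WZhang2014, Remark 5 and Thm. 10.2]
[cite: Mazur1978, Cor. 4.1] [cite: Miller2011LMS, Def. 1.1] -/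
theorem bsdp_of_kolyvaginWitness_of_mccallum
    (hGZ : ∀ (N : ℕ) [NeZero N] (W : WeierstrassCurve ℚ) (K : Type) [Field K] [NumberField K],
      gross_zagier N W K)
    (hKo : ∀ (N : ℕ) [NeZero N] (W : WeierstrassCurve ℚ) (K : Type) [Field K] [NumberField K],
      kolyvagin N W K)
    (hB : ∀ (N : ℕ) [NeZero N] (W : WeierstrassCurve ℚ) (K : Type) [Field K] [NumberField K],
      Kolyvagin1990_padicValNat_card_sha_le N W K)
    (hSk : Skinner2016.thmC_padicValRat_bsd_rank_zero)
    (hGZK : rank_eq_analyticRank_of_analyticRank_le_one) (hmod : hasEntireLFunction_rat)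
    (hnf : exists_isNewformOf) (hMaz : mazur_not_dvd_maninConstant_of_odd)
    (hrec : ∀ (N : ℕ) [NeZero N] (W : WeierstrassCurve ℚ) (K : Type) [Field K] [NumberField K],
      heegnerPointOfConductor_one_galoisConj N W K)
    (hMc : McCallum1991_pow_dvd_card_sha_primary_of_certificate)
    -- the pair
    (W : WeierstrassCurve ℚ) [W.IsElliptic] [W.IsGloballyMinimal] [NeZero (W.conductorNorm ℤ)]
    (p : ℕ) [hp' : Fact p.Prime]
    (hX : ClassX11b W p) (hram : Ram W p) (htam : ¬ p ∣ W.tamagawaProduct)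
    -- the Hoffstein–Luo field
    (K : Type) [Field K] [NumberField K] (hK : IsImaginaryQuadratic K) (hodd : Odd (NumberField.discr K))
    (hlt : NumberField.discr K < -4) (hHN : SatisfiesHeegnerHypothesis (W.conductorNorm ℤ) K)
    (hLt : (W.quadraticTwist (NumberField.discr K : ℚ)).entireLFunction 1 ≠ 0)
    -- ONE witness at ANY frame
    {Dt' : ModularParametrizationData W (W.conductorNorm ℤ)} {β' : ℤ} {ι' : K →+* ℂ} {n : ℕ}
    (d : KolyvaginHeegnerData Dt' β' ι' n)
    (hn : KolyvaginDescent.KolSupp (Zhang2014.IsKolyvaginPrime (W.conductorNorm ℤ) W K p) n)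
    (hne : d.kolyvaginClass hp'.out 1 ≠ 0) : BSDp W p := by
  have hp : p.Prime := Fact.out
  obtain ⟨hr, hp2, hmult, hirr⟩ := hX
  have hρ : Surj W p := surj_of_irr_of_ram W p hirr hram
  have h3 : NumberField.discr K ≠ -3 := by omega
  have h4 : NumberField.discr K ≠ -4 := by omega
  have hμ : ¬ p ∣ Units.torsionOrder K := by
    haveI : IsTotallyComplex K := hK.2
    rw [Literature.NumberTheory.DiophantineGeometry.torsionOrder_eq_two_of_discr_lt hK.1 hlt]
    intro h2
    have := Nat.le_of_dvd two_pos h2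
    have := hp.two_le
    omega
  -- a Heegner datum with the witness orientation, the witness Heegner point y_K' ∈ E(K)
  obtain ⟨H', hH'β⟩ := exists_heegnerDatum (W.conductorNorm ℤ) hK.discr_neg d.dvd_sq_sub
  obtain ⟨P', hP'⟩ := heegnerPointComplex_mem_range_map_holds (W.conductorNorm ℤ) W K hK hHN Dt' H' ι'
  -- a Manin-good datum, its Heegner point for the same (β', ι')
  obtain ⟨Dt, hc⟩ := exists_modularParametrizationData_not_dvd hnf hMaz
    integral_neronScaling_of_isGloballyMinimal_holds W rfl hp hp2
    (not_sq_dvd_conductorNorm_of_mult (W := W) (p := p) hmult) hirr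
  obtain ⟨P, hP⟩ := heegnerPointComplex_mem_range_map_holds (W.conductorNorm ℤ) W K hK hHN Dt H' ι'
  have hprop : Dt'.c • P = Dt.c • P' := by
    apply WeierstrassCurve.Affine.Point.map_injective (W' := W) (f := ι'.toRatAlgHom)
    rw [map_zsmul, map_zsmul, hP, hP',
      ModularParametrizationData.zsmul_heegnerPointComplex_eq Dt Dt' H']
  have hPinf : ¬ IsOfFinAddOrder P :=
    not_isOfFinAddOrder_of_heegner_of_analyticRank_eq_one W (W.conductorNorm ℤ) K Dt H' ι' P
      (hGZ _ W K) hmod hr hK hHN hLt hP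
  have hP'inf : ¬ IsOfFinAddOrder P' :=
    not_isOfFinAddOrder_of_heegner_of_analyticRank_eq_one W (W.conductorNorm ℤ) K Dt' H' ι' P'
      (hGZ _ W K) hmod hr hK hHN hLt hP'
  obtain ⟨hrank, hSha⟩ := hKo (W.conductorNorm ℤ) W K hK hHN ⟨Dt', H', ι', hP'⟩ hP'inf
  haveI : Finite (W.baseChange K).sha := hSha
  have hbot := torsionBy_eq_bot_of_isImaginaryQuadratic_of_hasIrreducibleModPGaloisRep W K hK hp hirr
  have hiv : ∀ x : (W.baseChange K).toAffine.Point, p • x = 0 → x = 0 := fun x hx ↦ by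
    have hmem : x ∈ AddSubgroup.torsionBy (W.baseChange K).toAffine.Point ((p : ℕ) : ℤ) := by
      rw [mem_torsionBy_iff, natCast_zsmul]
      exact hx
    rw [hbot] at hmem
    exact hmem
  haveI : Module.Finite ℤ (W.baseChange K).toAffine.Point := (W.baseChange K).module_finite_point_holds
  obtain ⟨M₀, x₀, hx₀, hmax⟩ := exists_pow_smul_eq_and_forall_ne hP'inf (p := p) hp.two_le
  have hdiv : ∃ Q : (W.baseChange K).toAffine.Point, ((p ^ M₀ : ℕ) : ℤ) • Q = P' :=
    ⟨x₀, by rw [natCast_zsmul]; exact hx₀⟩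
  have hndiv : ¬ ∃ Q : (W.baseChange K).toAffine.Point, ((p ^ (M₀ + 1) : ℕ) : ℤ) • Q = P' := by
    rintro ⟨Q, hQ⟩
    exact hmax Q (by rw [← natCast_zsmul]; exact hQ)
  obtain ⟨d₁⟩ := Summit.BirchSwinnertonDyer.BirchSwinnertonDyer.Theorems.kolyvaginRoadThree_towerData_of_grossCM
    (fun N _ W K _ _ ↦ phi_heegnerPointOfConductor_mem_range_map_ringClassField_holds N W K)
    (fun _ _ _ ↦ exists_generator_ringClassGalOver_holds) W K Dt' β' ι' 1 hK hHN d.dvd_sq_sub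
    squarefree_one (by simp)
  have hP'd : d₁.toGeomPoints d₁.derivedPoint = toGeomPoints (W.baseChange K) P' :=
    KolyvaginBottom.toGeomPoints_derivedPoint_one_eq (hrec _ W K) hK hHN hP' d₁ hH'β
  have hCM : ¬ W.HasCM := not_hasCM_of_hasMultiplicativeReductionAtPrime' W hmult
  have hsurj : ∀ m : ℕ, W.HasSurjectiveModNGaloisRep (p ^ m : ℕ) :=
    hasSurjectiveModNGaloisRep_pow_of_hasMultiplicativeReductionAtPrime W p hρ hram
  have hL' : IndexLowerBoundAt W p K P' :=
    indexLowerBoundAt_of_kolyvaginClass_one_ne_zero_of_mccallum W K hMc hCM hK h3 h4 hHN p hp2 hsurj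
      Dt' β' ι' d₁ P' hP'd hP'inf hrank hiv hdiv hndiv d hn hne
  have hL : IndexLowerBoundAt W p K P :=
    indexLowerBoundAt_of_zsmul_eq_zsmul hprop hc Dt'.maninConstant_ne_zero_holds hPinf hP'inf hL'
  have hD0 : (NumberField.discr K : ℚ) ≠ 0 := by exact_mod_cast NumberField.discr_ne_zero K
  haveI hEt : (W.quadraticTwist (NumberField.discr K : ℚ)).IsElliptic := W.isElliptic_quadraticTwist hD0
  obtain ⟨Cd, hCd⟩ := hasGlobalMinimalModel_rat_holds (W.quadraticTwist (NumberField.discr K : ℚ))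
  haveI := hCd
  exact bsdp_of_indexLowerBoundAt_of_heegnerData_of_odd W p K Dt H' ι' P (hGZ _ W K) (hKo _ W K)
    (hB _ W K) hSk hGZK hmod ⟨hr, hp2, hmult, hirr⟩ hram htam hK hodd hHN hP hc hμ hLt
    (Cd • W.quadraticTwist (NumberField.discr K : ℚ)) Cd rfl hL

/-! ### §2 `p ≥ 5`: the cell's typed crux K-SZ14♯ (∃-framed) ⟹ `BSD(E,p)` on the whole Locus -/

/-- **K-SZ14♯ ⟹ the K2 leaf on the Locus.** For `(E,p) ∈` X11b, `5 ≤ p`, a (ram) witness and `p ∤ ∏c` (the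
Locus of route p2 ∕ ErratumRoadFive: cw 2 093 111): if the typed crux `Koly.SkinnerZhangSharp W p K` holds at
every imaginary quadratic Heegner field `K` of `N_E` (its own binder list), then `BSDp W p` — at the Hoffstein–Luo
field (`exists_admissibleField_of_rootNumber_eq_neg_one`) via §1. CONDITIONAL on `hSZs` (OPEN, memo-proved
MEMO-v5, referee PASS — not print) and `hMc`; nothing booked.
[cite: SkinnerZhang2014, Thm. 1.3 (shape)] [cite: McCallumLMS1991, §5 Cor. 5.6] [cite: Miller2011LMS, Def. 1.1] -/
theorem bsdp_of_skinnerZhangSharp_of_mccallum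
    (hGZ : ∀ (N : ℕ) [NeZero N] (W : WeierstrassCurve ℚ) (K : Type) [Field K] [NumberField K],
      gross_zagier N W K)
    (hKo : ∀ (N : ℕ) [NeZero N] (W : WeierstrassCurve ℚ) (K : Type) [Field K] [NumberField K],
      kolyvagin N W K)
    (hB : ∀ (N : ℕ) [NeZero N] (W : WeierstrassCurve ℚ) (K : Type) [Field K] [NumberField K],
      Kolyvagin1990_padicValNat_card_sha_le N W K)
    (hSk : Skinner2016.thmC_padicValRat_bsd_rank_zero)
    (hGZK : rank_eq_analyticRank_of_analyticRank_le_one) (hmod : hasEntireLFunction_rat)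
    (hnf : exists_isNewformOf) (hHL : HoffsteinLuo1997_exists_twist_L_one_ne_zero)
    (hMaz : mazur_not_dvd_maninConstant_of_odd)
    (hrec : ∀ (N : ℕ) [NeZero N] (W : WeierstrassCurve ℚ) (K : Type) [Field K] [NumberField K],
      heegnerPointOfConductor_one_galoisConj N W K)
    (hMc : McCallum1991_pow_dvd_card_sha_primary_of_certificate)
    (W : WeierstrassCurve ℚ) [W.IsElliptic] [W.IsGloballyMinimal] [NeZero (W.conductorNorm ℤ)]
    (p : ℕ) [Fact p.Prime]
    (hSZs : ∀ (K : Type) [Field K] [NumberField K], SkinnerZhangSharp W p K)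
    (hX : ClassX11b W p) (hp5 : 5 ≤ p) (hram : Ram W p) (htam : ¬ p ∣ W.tamagawaProduct) :
    BSDp W p := by
  have hw : W.rootNumber = -1 := by
    rw [WeierstrassCurve.rootNumber_eq_neg_one_pow_analyticRank_of_exists_isNewformOf hnf W, hX.1]
    norm_num
  obtain ⟨K, _, _, hK, hodd, hlt, hHN, -, hLt⟩ :=
    exists_admissibleField_of_rootNumber_eq_neg_one hnf hHL W hw p
  obtain ⟨Dt', β', ι', n, d, hn, -, hne⟩ := hSZs K hp5 hX.2.2.1 hX.2.2.2 hram htam hK hHN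
  exact bsdp_of_kolyvaginWitness_of_mccallum hGZ hKo hB hSk hGZK hmod hnf hMaz hrec hMc W p hX hram htam K
    hK hodd hlt hHN hLt d hn hne

/-! ### §3 `p = 3` (route `KolyvaginRoadThree`): the ∃-frame weakening of crux 19574 and the leaf on A1 -/

/-- **The ∃-FRAME weakening of the deciding crux ⟹ `BSD(E,3)` on A1.** If every Hoffstein–Luo A1 pair
`(E, K)` (ClassX11b at 3, ρ̄ onto, (ram), `3 ∤ ∏c`; `K` imaginary quadratic, `d_K` odd, Heegner for `N_E`,
`L(E^{d_K},1) ≠ 0`, `d_K ≠ −3`, AND `d_K < −4`) carries SOME frame `(Dt, β, ι)` — no Manin-good binder — and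
SOME `n ∈ Λ₃` with `c_1(n) ≠ 0`, then `BSDp W 3` for every `E` on A1 (via §1 at the Hoffstein–Luo field).
Strictly WEAKER hypothesis than `ZhangSharpFrameAtThreeHL` (∀ Manin-good frames); same conclusion as koly's
`bsdp_onA1_of_zhangSharpFrameAtThreeHL`. CONDITIONAL; nothing booked.
[cite: WZhang2014, Thm. 1.1, Remark 5] [cite: McCallumLMS1991, §5 Cor. 5.6] -/
theorem bsdp_three_onA1_of_existsKolyvaginWitnessHL
    (hGZ : ∀ (N : ℕ) [NeZero N] (W : WeierstrassCurve ℚ) (K : Type) [Field K] [NumberField K],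
      gross_zagier N W K)
    (hKo : ∀ (N : ℕ) [NeZero N] (W : WeierstrassCurve ℚ) (K : Type) [Field K] [NumberField K],
      kolyvagin N W K)
    (hB : ∀ (N : ℕ) [NeZero N] (W : WeierstrassCurve ℚ) (K : Type) [Field K] [NumberField K],
      Kolyvagin1990_padicValNat_card_sha_le N W K)
    (hSk : Skinner2016.thmC_padicValRat_bsd_rank_zero)
    (hGZK : rank_eq_analyticRank_of_analyticRank_le_one) (hmod : hasEntireLFunction_rat)
    (hnf : exists_isNewformOf) (hHL : HoffsteinLuo1997_exists_twist_L_one_ne_zero)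
    (hMaz : mazur_not_dvd_maninConstant_of_odd)
    (hrec : ∀ (N : ℕ) [NeZero N] (W : WeierstrassCurve ℚ) (K : Type) [Field K] [NumberField K],
      heegnerPointOfConductor_one_galoisConj N W K)
    (hMc : McCallum1991_pow_dvd_card_sha_primary_of_certificate)
    (hZ : ∀ (W : WeierstrassCurve ℚ) [W.IsElliptic] [W.IsGloballyMinimal] [NeZero (W.conductorNorm ℤ)]
      (K : Type) [Field K] [NumberField K],
      ClassX11b W 3 → Rank1Residual.Surj W 3 → Rank1Residual.Ram W 3 → ¬ 3 ∣ W.tamagawaProduct →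
      IsImaginaryQuadratic K → Odd (NumberField.discr K) → NumberField.discr K < -4 →
      SatisfiesHeegnerHypothesis (W.conductorNorm ℤ) K →
      (W.quadraticTwist (NumberField.discr K : ℚ)).entireLFunction 1 ≠ 0 →
      ∃ (Dt : ModularParametrizationData W (W.conductorNorm ℤ)) (β : ℤ) (ι : K →+* ℂ) (n : ℕ)
        (d : KolyvaginHeegnerData Dt β ι n),
        KolyvaginDescent.KolSupp (Zhang2014.IsKolyvaginPrime (W.conductorNorm ℤ) W K 3) n ∧
          d.kolyvaginClass Nat.prime_three 1 ≠ 0) :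
    ∀ (W : WeierstrassCurve ℚ) [W.IsElliptic] [W.IsGloballyMinimal],
      ClassX11b W 3 → Ram W 3 → ¬ 3 ∣ W.tamagawaProduct → BSDp W 3 := by
  intro W _ _ hX hram htam
  haveI : NeZero (W.conductorNorm ℤ) := ⟨(W.conductorNorm_pos_holds).ne'⟩
  haveI : Fact (Nat.Prime 3) := ⟨Nat.prime_three⟩
  have hρ : Surj W 3 := surj_of_irr_of_ram W 3 hX.2.2.2 hram
  have hw : W.rootNumber = -1 := by
    rw [WeierstrassCurve.rootNumber_eq_neg_one_pow_analyticRank_of_exists_isNewformOf hnf W, hX.1]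
    norm_num
  obtain ⟨K, _, _, hK, hodd, hlt, hHN, -, hLt⟩ :=
    exists_admissibleField_of_rootNumber_eq_neg_one hnf hHL W hw 3
  obtain ⟨Dt', β', ι', n, d, hn, hne⟩ := hZ W K hX hρ hram htam hK hodd hlt hHN hLt
  exact bsdp_of_kolyvaginWitness_of_mccallum hGZ hKo hB hSk hGZK hmod hnf hMaz hrec hMc W 3 hX hram htam K
    hK hodd hlt hHN hLt d hn hne

/-- **Conversely, the crux `ZhangSharpFrameAtThreeHL` implies its ∃-frame weakening** (a Manin-good frame
exists on every Hoffstein–Luo pair: `exists_maninDatum_of_odd`, and the crux gives a non-zero class THERE).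
Pure bookkeeping. [cite: Mazur1978, Cor. 4.1] -/
theorem existsKolyvaginWitnessHL_of_zhangSharpFrameAtThreeHL (hnf : exists_isNewformOf)
    (hMaz : mazur_not_dvd_maninConstant_of_odd)
    (hZ : Summit.BirchSwinnertonDyer.BirchSwinnertonDyer.Theses.KolyvaginRoadThree.ZhangSharpFrameAtThreeHL) :
    ∀ (W : WeierstrassCurve ℚ) [W.IsElliptic] [W.IsGloballyMinimal] [NeZero (W.conductorNorm ℤ)]
      (K : Type) [Field K] [NumberField K],
      ClassX11b W 3 → Rank1Residual.Surj W 3 → Rank1Residual.Ram W 3 → ¬ 3 ∣ W.tamagawaProduct →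
      IsImaginaryQuadratic K → Odd (NumberField.discr K) → NumberField.discr K < -4 →
      SatisfiesHeegnerHypothesis (W.conductorNorm ℤ) K →
      (W.quadraticTwist (NumberField.discr K : ℚ)).entireLFunction 1 ≠ 0 →
      ∃ (Dt : ModularParametrizationData W (W.conductorNorm ℤ)) (β : ℤ) (ι : K →+* ℂ) (n : ℕ)
        (d : KolyvaginHeegnerData Dt β ι n),
        KolyvaginDescent.KolSupp (Zhang2014.IsKolyvaginPrime (W.conductorNorm ℤ) W K 3) n ∧
          d.kolyvaginClass Nat.prime_three 1 ≠ 0 := by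
  intro W _ _ _ K _ _ hX hρ hram htam hK hodd hlt hHN hLt
  haveI : Fact (Nat.Prime 3) := ⟨Nat.prime_three⟩
  have h3 : NumberField.discr K ≠ -3 := by omega
  obtain ⟨Dt, H, ι, P, -, hc⟩ := exists_maninDatum_of_odd hnf hMaz
    integral_neronScaling_of_isGloballyMinimal_holds W 3 (W.conductorNorm ℤ) K rfl (by decide) hX.2.2.1
    hX.2.2.2 hK hHN
  obtain ⟨n, d, hn, hne⟩ := hZ W K Dt H.β ι hX hX.2.2.1 hρ hram htam hK hodd hHN hLt h3 H.dvd_sq_sub hc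
  exact ⟨Dt, H.β, ι, n, d, hn, hne⟩

/-! ### §4 `p ≥ 5`: the memo-proved typed statement SZ14♭ (Thm 1.3 without the `𝓛`-clause) ⟹ `BSD(E,p)` -/

/-- **SZ14♭ ⟹ the K2 leaf on its locus.** For `(E,p) ∈` X11b, `5 ≤ p`, `ρ̄` not finite at `p` (`p ∤ v_p(Δ_min)`),
♠(2) (every multiplicative `ℓ ≠ p` E[p]-ramified) and a (ram) witness: if the typed statement
`Koly.SkinnerZhangFlat W p K` (= SZ14 Thm 1.3 with the split-`p` `𝓛`-clause DELETED; koly MEMO-v4 THEOREM B♭,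
referee PASS; `@[conjecture]`, ∃-framed) holds at every imaginary quadratic Heegner field, then `BSDp W p` — the
Tamagawa condition being implied (`not_dvd_tamagawaProduct_of_szHypotheses`). CONDITIONAL on `hSZf` and `hMc`;
nothing booked. [cite: SkinnerZhang2014, Thm. 1.3 (shape, 𝓛-clause deleted)] [cite: McCallumLMS1991, §5 Cor. 5.6]
[cite: Miller2011LMS, Def. 1.1] -/
theorem bsdp_of_skinnerZhangFlat_of_mccallum
    (hGZ : ∀ (N : ℕ) [NeZero N] (W : WeierstrassCurve ℚ) (K : Type) [Field K] [NumberField K],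
      gross_zagier N W K)
    (hKo : ∀ (N : ℕ) [NeZero N] (W : WeierstrassCurve ℚ) (K : Type) [Field K] [NumberField K],
      kolyvagin N W K)
    (hB : ∀ (N : ℕ) [NeZero N] (W : WeierstrassCurve ℚ) (K : Type) [Field K] [NumberField K],
      Kolyvagin1990_padicValNat_card_sha_le N W K)
    (hSk : Skinner2016.thmC_padicValRat_bsd_rank_zero)
    (hGZK : rank_eq_analyticRank_of_analyticRank_le_one) (hmod : hasEntireLFunction_rat)
    (hnf : exists_isNewformOf) (hHL : HoffsteinLuo1997_exists_twist_L_one_ne_zero)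
    (hMaz : mazur_not_dvd_maninConstant_of_odd)
    (hrec : ∀ (N : ℕ) [NeZero N] (W : WeierstrassCurve ℚ) (K : Type) [Field K] [NumberField K],
      heegnerPointOfConductor_one_galoisConj N W K)
    (hMc : McCallum1991_pow_dvd_card_sha_primary_of_certificate)
    (W : WeierstrassCurve ℚ) [W.IsElliptic] [W.IsGloballyMinimal] [NeZero (W.conductorNorm ℤ)]
    (p : ℕ) [Fact p.Prime]
    (hSZf : ∀ (K : Type) [Field K] [NumberField K], SkinnerZhangFlat W p K)
    (hX : ClassX11b W p) (hp5 : 5 ≤ p)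
    (hfin : ¬ p ∣ padicValInt p W.minimalDiscriminantInt)
    (hramAll : ∀ (ℓ : ℕ) [Fact ℓ.Prime], ℓ ≠ p → W.HasMultiplicativeReductionAtPrime ℓ →
      ¬ p ∣ padicValInt ℓ W.minimalDiscriminantInt)
    (hram : Ram W p) : BSDp W p := by
  have htam : ¬ p ∣ W.tamagawaProduct :=
    not_dvd_tamagawaProduct_of_szHypotheses W (Fact.out) hp5 hfin hramAll
  have hw : W.rootNumber = -1 := by
    rw [WeierstrassCurve.rootNumber_eq_neg_one_pow_analyticRank_of_exists_isNewformOf hnf W, hX.1]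
    norm_num
  obtain ⟨K, _, _, hK, hodd, hlt, hHN, -, hLt⟩ :=
    exists_admissibleField_of_rootNumber_eq_neg_one hnf hHL W hw p
  obtain ⟨Dt', β', ι', n, d, hn, -, hne⟩ :=
    hSZf K hp5 hX.2.2.1 hX.2.2.2 hfin (fun ℓ _ hℓ hm ↦ hramAll ℓ hℓ hm) hram hK hHN
  exact bsdp_of_kolyvaginWitness_of_mccallum hGZ hKo hB hSk hGZK hmod hnf hMaz hrec hMc W p hX hram htam K
    hK hodd hlt hHN hLt d hn hne

end Summit.BirchSwinnertonDyer.Rank1Residual.X11b.Three.Koly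

end
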